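import Mathlib
import Literature.MathematicalPhysics.MHD.BallooningSAlphaStableSide
import HarnessLib

/-!
# The stable side of the `s–α` ballooning model, §6: a CORRECTED TAIL AMPLITUDE on `[T, ∞)` whose residual has NO
# oscillatory `θ⁻³` part — `w(θ) = 1 − c/θ + κ cos θ/θ² + (½κ(α/s) sin θ cos θ + 4κ sin θ − cκ cos θ)/θ³`, `κ = α/s²`

Companion of `BallooningSAlphaStableSide.lean` §5 (gridfusion-lit-4; the engine `stableSide_of_core_amplitude_tail`).  There
the tail `(1 − c/θ)(1 + κ cos θ/θ²)` leaves an OSCILLATORY residual `θ⁻³·(4αs⁴ sin θ + 2α²s³ sin θ cos θ)/s⁶` of the same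
order as the decay term `−2c/θ³`, so the tail condition `tailBound ≥ 0` forces `c > 2α/s² + α²/s³` and with it a junction
slope `≈ c/T²` that the core amplitude of a STRONGLY stable point (second stability, or a first-stability point within
`2 %` of the marginal `α`) cannot deliver (gridfusion-model-7 I4291 (D): at `(s, α) = (3/2, 15/4)` the even solution has
`F′/F(36) = 0.0089` against a required `0.0212`).  Here the three `θ⁻³` corrections `p sin θ cos θ + q sin θ + r cos θ`,
`p = α²/(2s³)`, `q = 4α/s²`, `r = −cα/s²`, are chosen so that the `θ⁻³` part of the residual is EXACTLY `−2c/θ³`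
(`tail2Coeff6 ≡ 0`: the expansion `2s³θ⁵·residual = −4cs⁷θ⁶ + Σ_{k ≤ 5} tail2Coeffₖ(sin θ, cos θ) θ^k`, 100 signed
monomials, generated by computer algebra (kit j310516) and CHECKED by `ring` in `amplitudeResidual_tail2Amplitude`).
Consequently the tail condition `tail2Bound s α c T = 4cs⁷T⁶ − Σₖ tail2Majₖ T^k ≥ 0` only needs `c = O(1/T)`, and the
junction number `tail2Slope/tail2Floor ≈ (c + κ)/T²` is small: exact rational arithmetic on the majorant gives, e.g.,
`(3/2, 15/4)`: `c = 3` at `T = 36` (junction `≈ 0.004 < 0.0089`); `(1, 3/5)`: `c = 1` at `T = 16`; `(3, 143/80)`: `c = 1/2`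
at `T = 12` — VALIDATED sizing only (lit/4-salpha/tail2cas.py, gen_tail4.py); every use is re-done by `norm_num` in an
instance file.  The final theorem `stableSide_of_core_amplitude_tail2` has the SAME core hypotheses as §5's and replaces
`(c < T, α < s²T², tailBound ≥ 0, junction)` by `(0 < T, tail2Floor > 0, tail2Bound ≥ 0, tail2Slope/tail2Floor ≤ F′(T)/F(T))`.
gridfusion-lit-4 (g13), 2026-08-28.  0 facts, 0 kit in the kernel, standard axioms.

References: J. P. Freidberg, *Ideal MHD* (CUP 2014) §12.6.2 eq. (12.97) [Freidberg2014]; P. Hartman, *ODE* (SIAM 2002)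
Ch. XI §6 Thm. 6.2 (Picone / supersolution) [Hartman2002].  The two-scale corrected amplitude is an elementary
construction of this file (WKB-type bookkeeping), not a quoted result.
-/

noncomputable section

open Real MeasureTheory intervalIntegral Set

namespace Literature.MathematicalPhysics.MHD

namespace Ballooning

namespace SAlpha

/-! ## §6.1 The corrected tail amplitude and its derivatives -/

/-- The `θ⁻³` numerator `N(θ) = p sin θ cos θ + q sin θ + r cos θ`, `p = α²/(2s³)`, `q = 4α/s²`, `r = −cα/s²`. [cite: Freidberg2014, §12.6.2 eq. (12.97)] (ours) -/
def tail2N (s α c : ℝ) (θ : ℝ) : ℝ :=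
  α ^ 2 / (2 * s ^ 3) * (Real.sin θ * Real.cos θ) + 4 * α / s ^ 2 * Real.sin θ - c * α / s ^ 2 * Real.cos θ

/-- `N′`. [cite: Freidberg2014, §12.6.2 eq. (12.97)] (ours) -/
def tail2N1 (s α c : ℝ) (θ : ℝ) : ℝ :=
  α ^ 2 / (2 * s ^ 3) * (Real.cos θ * Real.cos θ - Real.sin θ * Real.sin θ) + 4 * α / s ^ 2 * Real.cos θ
    + c * α / s ^ 2 * Real.sin θ

/-- `N″`. [cite: Freidberg2014, §12.6.2 eq. (12.97)] (ours) -/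
def tail2N2 (s α c : ℝ) (θ : ℝ) : ℝ :=
  -(4 * (α ^ 2 / (2 * s ^ 3))) * (Real.sin θ * Real.cos θ) - 4 * α / s ^ 2 * Real.sin θ + c * α / s ^ 2 * Real.cos θ

/-- THE CORRECTED TAIL AMPLITUDE `w(θ) = 1 − c/θ + (α/s²) cos θ/θ² + N(θ)/θ³`. [cite: Freidberg2014, §12.6.2 eq. (12.97)]
(an explicit supersolution family for its Liouville normal form; construction ours) -/
def tail2Amplitude (s α c : ℝ) (θ : ℝ) : ℝ :=
  (1 - c / θ) + α / s ^ 2 * (Real.cos θ / θ ^ 2) + tail2N s α c θ / θ ^ 3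

/-- `w′` (closed form). [cite: Freidberg2014, §12.6.2 eq. (12.97)] (ours) -/
def tail2AmplitudeDeriv (s α c : ℝ) (θ : ℝ) : ℝ :=
  c / θ ^ 2 + α / s ^ 2 * (-Real.sin θ / θ ^ 2 - 2 * Real.cos θ / θ ^ 3)
    + tail2N1 s α c θ / θ ^ 3 - 3 * tail2N s α c θ / θ ^ 4

/-- `w″` (closed form). [cite: Freidberg2014, §12.6.2 eq. (12.97)] (ours) -/
def tail2AmplitudeDeriv2 (s α c : ℝ) (θ : ℝ) : ℝ :=
  -2 * c / θ ^ 3 + α / s ^ 2 * (-Real.cos θ / θ ^ 2 + 4 * Real.sin θ / θ ^ 3 + 6 * Real.cos θ / θ ^ 4)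
    + tail2N2 s α c θ / θ ^ 3 - 6 * tail2N1 s α c θ / θ ^ 4 + 12 * tail2N s α c θ / θ ^ 5

/-- `N′` is the derivative of `N`. [cite: Freidberg2014, §12.6.2 eq. (12.97)] (calculus bookkeeping for its Liouville normal form; ours) -/
theorem hasDerivAt_tail2N (s α c θ : ℝ) : HasDerivAt (tail2N s α c) (tail2N1 s α c θ) θ := by
  have h1 := ((Real.hasDerivAt_sin θ).mul (Real.hasDerivAt_cos θ)).const_mul (α ^ 2 / (2 * s ^ 3))
  have h2 := (Real.hasDerivAt_sin θ).const_mul (4 * α / s ^ 2)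
  have h3 := (Real.hasDerivAt_cos θ).const_mul (c * α / s ^ 2)
  have h := (h1.add h2).sub h3
  have e : tail2N s α c = fun x => α ^ 2 / (2 * s ^ 3) * (Real.sin x * Real.cos x) + 4 * α / s ^ 2 * Real.sin x
      - c * α / s ^ 2 * Real.cos x := by
    funext x; rfl
  rw [e]
  exact h.congr_deriv (by unfold tail2N1; ring)

/-- `N″` is the derivative of `N′`. [cite: Freidberg2014, §12.6.2 eq. (12.97)] (calculus bookkeeping for its Liouville normal form; ours) -/
theorem hasDerivAt_tail2N1 (s α c θ : ℝ) : HasDerivAt (tail2N1 s α c) (tail2N2 s α c θ) θ := by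
  have h1 := (((Real.hasDerivAt_cos θ).mul (Real.hasDerivAt_cos θ)).sub
    ((Real.hasDerivAt_sin θ).mul (Real.hasDerivAt_sin θ))).const_mul (α ^ 2 / (2 * s ^ 3))
  have h2 := (Real.hasDerivAt_cos θ).const_mul (4 * α / s ^ 2)
  have h3 := (Real.hasDerivAt_sin θ).const_mul (c * α / s ^ 2)
  have h := (h1.add h2).add h3
  have e : tail2N1 s α c = fun x => α ^ 2 / (2 * s ^ 3) * (Real.cos x * Real.cos x - Real.sin x * Real.sin x)
      + 4 * α / s ^ 2 * Real.cos x + c * α / s ^ 2 * Real.sin x := by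
    funext x; rfl
  rw [e]
  exact h.congr_deriv (by unfold tail2N2; ring)

/-- `w′` is the derivative of `w` away from `θ = 0`. [cite: Freidberg2014, §12.6.2 eq. (12.97)] (ours) -/
theorem hasDerivAt_tail2Amplitude {s α c θ : ℝ} (hθ : θ ≠ 0) :
    HasDerivAt (tail2Amplitude s α c) (tail2AmplitudeDeriv s α c θ) θ := by
  have hθ2 : θ ^ 2 ≠ 0 := pow_ne_zero 2 hθ
  have hθ3 : θ ^ 3 ≠ 0 := pow_ne_zero 3 hθ
  have hp2 : HasDerivAt (fun θ : ℝ => θ ^ 2) (2 * θ) θ := by simpa using (hasDerivAt_pow 2 θ)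
  have hp3 : HasDerivAt (fun θ : ℝ => θ ^ 3) (3 * θ ^ 2) θ := by simpa using (hasDerivAt_pow 3 θ)
  have h1 : HasDerivAt (fun θ : ℝ => 1 - c / θ) (-((0 * θ - c * 1) / θ ^ 2)) θ :=
    ((hasDerivAt_const θ c).div (hasDerivAt_id θ) hθ).const_sub 1
  have h2 := ((Real.hasDerivAt_cos θ).div hp2 hθ2).const_mul (α / s ^ 2)
  have h3 := (hasDerivAt_tail2N s α c θ).div hp3 hθ3
  have h := (h1.add h2).add h3
  have e : tail2Amplitude s α c = fun x => (1 - c / x) + α / s ^ 2 * (Real.cos x / x ^ 2)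
      + tail2N s α c x / x ^ 3 := by
    funext x; rfl
  rw [e]
  refine h.congr_deriv ?_
  unfold tail2AmplitudeDeriv
  field_simp
  ring

/-- `w″` is the derivative of `w′` away from `θ = 0`. [cite: Freidberg2014, §12.6.2 eq. (12.97)] (ours) -/
theorem hasDerivAt_tail2AmplitudeDeriv {s α c θ : ℝ} (hθ : θ ≠ 0) :
    HasDerivAt (tail2AmplitudeDeriv s α c) (tail2AmplitudeDeriv2 s α c θ) θ := by
  have hθ2 : θ ^ 2 ≠ 0 := pow_ne_zero 2 hθ
  have hθ3 : θ ^ 3 ≠ 0 := pow_ne_zero 3 hθ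
  have hθ4 : θ ^ 4 ≠ 0 := pow_ne_zero 4 hθ
  have hp2 : HasDerivAt (fun θ : ℝ => θ ^ 2) (2 * θ) θ := by simpa using (hasDerivAt_pow 2 θ)
  have hp3 : HasDerivAt (fun θ : ℝ => θ ^ 3) (3 * θ ^ 2) θ := by simpa using (hasDerivAt_pow 3 θ)
  have hp4 : HasDerivAt (fun θ : ℝ => θ ^ 4) (4 * θ ^ 3) θ := by simpa using (hasDerivAt_pow 4 θ)
  have hA : HasDerivAt (fun θ : ℝ => c / θ ^ 2) ((0 * θ ^ 2 - c * (2 * θ)) / (θ ^ 2) ^ 2) θ :=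
    (hasDerivAt_const θ c).div hp2 hθ2
  have hD : HasDerivAt (fun θ : ℝ => -Real.sin θ / θ ^ 2 - 2 * Real.cos θ / θ ^ 3)
      ((-Real.cos θ * θ ^ 2 - -Real.sin θ * (2 * θ)) / (θ ^ 2) ^ 2
        - ((2 * -Real.sin θ) * θ ^ 3 - 2 * Real.cos θ * (3 * θ ^ 2)) / (θ ^ 3) ^ 2) θ := by
    have h1 := (Real.hasDerivAt_sin θ).neg.div hp2 hθ2
    have h2 := ((Real.hasDerivAt_cos θ).const_mul 2).div hp3 hθ3
    exact h1.sub h2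
  have hB := hD.const_mul (α / s ^ 2)
  have hC := (hasDerivAt_tail2N1 s α c θ).div hp3 hθ3
  have hE := ((hasDerivAt_tail2N s α c θ).div hp4 hθ4).const_mul (3 : ℝ)
  have h := ((hA.add hB).add hC).sub hE
  have e : tail2AmplitudeDeriv s α c = fun x => c / x ^ 2
      + α / s ^ 2 * (-Real.sin x / x ^ 2 - 2 * Real.cos x / x ^ 3)
      + tail2N1 s α c x / x ^ 3 - 3 * (tail2N s α c x / x ^ 4) := by
    funext x; unfold tail2AmplitudeDeriv; ring
  rw [e]
  refine h.congr_deriv ?_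
  unfold tail2AmplitudeDeriv2
  field_simp
  ring

/-- `w″` is continuous on every ray `[T, ∞)`, `T > 0`. [cite: Freidberg2014, §12.6.2 eq. (12.97)] (calculus bookkeeping for its Liouville normal form; ours) -/
theorem continuousOn_tail2AmplitudeDeriv2 {s α c T : ℝ} (hT : 0 < T) :
    ContinuousOn (tail2AmplitudeDeriv2 s α c) (Ici T) := by
  have hne : ∀ θ ∈ Ici T, θ ≠ 0 := fun θ hθ => (hT.trans_le hθ).ne'
  have key : ∀ θ ∈ Ici T, ContinuousAt (tail2AmplitudeDeriv2 s α c) θ := by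
    intro θ hθ
    have h0 : θ ≠ 0 := hne θ hθ
    unfold tail2AmplitudeDeriv2 tail2N tail2N1 tail2N2
    have hs := Real.continuous_sin
    have hc := Real.continuous_cos
    apply ContinuousAt.add
    · apply ContinuousAt.sub
      · apply ContinuousAt.add
        · apply ContinuousAt.add
          · exact (continuousAt_const.div (continuousAt_id.pow 3) (pow_ne_zero 3 h0))
          · refine continuousAt_const.mul ?_
            refine ContinuousAt.add (ContinuousAt.add ?_ ?_) ?_
            · exact (hc.continuousAt.neg.div (continuousAt_id.pow 2) (pow_ne_zero 2 h0))
            · exact ((continuousAt_const.mul hs.continuousAt).div (continuousAt_id.pow 3) (pow_ne_zero 3 h0))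
            · exact ((continuousAt_const.mul hc.continuousAt).div (continuousAt_id.pow 4) (pow_ne_zero 4 h0))
        · refine ContinuousAt.div ?_ (continuousAt_id.pow 3) (pow_ne_zero 3 h0)
          exact ((continuousAt_const.mul (hs.continuousAt.mul hc.continuousAt)).sub
            (continuousAt_const.mul hs.continuousAt)).add (continuousAt_const.mul hc.continuousAt)
      · refine ContinuousAt.div ?_ (continuousAt_id.pow 4) (pow_ne_zero 4 h0)
        exact continuousAt_const.mul (((continuousAt_const.mul ((hc.continuousAt.mul hc.continuousAt).sub
          (hs.continuousAt.mul hs.continuousAt))).add (continuousAt_const.mul hc.continuousAt)).add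
          (continuousAt_const.mul hs.continuousAt))
    · refine ContinuousAt.div ?_ (continuousAt_id.pow 5) (pow_ne_zero 5 h0)
      exact continuousAt_const.mul (((continuousAt_const.mul (hs.continuousAt.mul hc.continuousAt)).add
        (continuousAt_const.mul hs.continuousAt)).sub (continuousAt_const.mul hc.continuousAt))
  exact fun θ hθ => (key θ hθ).continuousWithinAt

/-! ## §6.2 A positive floor and a slope bound (the junction number) -/

/-- `M = p + q + cκ = α²/(2s³) + 4α/s² + cα/s²`: a bound of `|N|` (and, with `2p`, of `|N′|`). [cite: Freidberg2014, §12.6.2 eq. (12.97)] (calculus bookkeeping for its Liouville normal form; ours) -/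
def tail2M (s α c : ℝ) : ℝ := α ^ 2 / (2 * s ^ 3) + 4 * α / s ^ 2 + c * α / s ^ 2

/-- THE FLOOR `1 − c/T − κ/T² − M/T³` of the corrected amplitude on `[T, ∞)`. [cite: Freidberg2014, §12.6.2 eq. (12.97)] (calculus bookkeeping for its Liouville normal form; ours) -/
def tail2Floor (s α c T : ℝ) : ℝ := 1 - c / T - α / s ^ 2 / T ^ 2 - tail2M s α c / T ^ 3

/-- THE SLOPE BOUND `c/T² + κ(T + 2)/T³ + (M + α²/(2s³))/T³ + 3M/T⁴ ≥ w′(T)`. [cite: Freidberg2014, §12.6.2 eq. (12.97)] (calculus bookkeeping for its Liouville normal form; ours) -/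
def tail2Slope (s α c T : ℝ) : ℝ :=
  c / T ^ 2 + α / s ^ 2 * (T + 2) / T ^ 3 + (tail2M s α c + α ^ 2 / (2 * s ^ 3)) / T ^ 3 + 3 * tail2M s α c / T ^ 4

/-- `|N(θ)| ≤ M`. [cite: Freidberg2014, §12.6.2 eq. (12.97)] (calculus bookkeeping for its Liouville normal form; ours) -/
theorem abs_tail2N_le {s α c θ : ℝ} (hs : 0 < s) (hα : 0 ≤ α) (hc : 0 ≤ c) :
    |tail2N s α c θ| ≤ tail2M s α c := by
  unfold tail2N tail2M
  have hS := Real.abs_sin_le_one θ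
  have hC := Real.abs_cos_le_one θ
  have hSC : |Real.sin θ * Real.cos θ| ≤ 1 := by
    rw [abs_mul]; exact mul_le_one₀ hS (abs_nonneg _) hC
  have hp : 0 ≤ α ^ 2 / (2 * s ^ 3) := by positivity
  have hq : 0 ≤ 4 * α / s ^ 2 := by positivity
  have hr : 0 ≤ c * α / s ^ 2 := by positivity
  have e1 : |α ^ 2 / (2 * s ^ 3) * (Real.sin θ * Real.cos θ)| ≤ α ^ 2 / (2 * s ^ 3) := by
    rw [abs_mul, abs_of_nonneg hp]; exact mul_le_of_le_one_right hp hSC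
  have e2 : |4 * α / s ^ 2 * Real.sin θ| ≤ 4 * α / s ^ 2 := by
    rw [abs_mul, abs_of_nonneg hq]; exact mul_le_of_le_one_right hq hS
  have e3 : |c * α / s ^ 2 * Real.cos θ| ≤ c * α / s ^ 2 := by
    rw [abs_mul, abs_of_nonneg hr]; exact mul_le_of_le_one_right hr hC
  calc |α ^ 2 / (2 * s ^ 3) * (Real.sin θ * Real.cos θ) + 4 * α / s ^ 2 * Real.sin θ - c * α / s ^ 2 * Real.cos θ|
      ≤ |α ^ 2 / (2 * s ^ 3) * (Real.sin θ * Real.cos θ) + 4 * α / s ^ 2 * Real.sin θ|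
          + |c * α / s ^ 2 * Real.cos θ| := abs_sub _ _
    _ ≤ (|α ^ 2 / (2 * s ^ 3) * (Real.sin θ * Real.cos θ)| + |4 * α / s ^ 2 * Real.sin θ|)
          + |c * α / s ^ 2 * Real.cos θ| := by gcongr; exact abs_add_le _ _
    _ ≤ α ^ 2 / (2 * s ^ 3) + 4 * α / s ^ 2 + c * α / s ^ 2 := by linarith

/-- `|N′(θ)| ≤ M + p` (`|cos² − sin²| ≤ 2`). [cite: Freidberg2014, §12.6.2 eq. (12.97)] (calculus bookkeeping for its Liouville normal form; ours) -/
theorem abs_tail2N1_le {s α c θ : ℝ} (hs : 0 < s) (hα : 0 ≤ α) (hc : 0 ≤ c) :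
    |tail2N1 s α c θ| ≤ tail2M s α c + α ^ 2 / (2 * s ^ 3) := by
  unfold tail2N1 tail2M
  have hS := Real.abs_sin_le_one θ
  have hC := Real.abs_cos_le_one θ
  have hCC : |Real.cos θ * Real.cos θ| ≤ 1 := by rw [abs_mul]; exact mul_le_one₀ hC (abs_nonneg _) hC
  have hSS : |Real.sin θ * Real.sin θ| ≤ 1 := by rw [abs_mul]; exact mul_le_one₀ hS (abs_nonneg _) hS
  have hd : |Real.cos θ * Real.cos θ - Real.sin θ * Real.sin θ| ≤ 2 := by
    calc |Real.cos θ * Real.cos θ - Real.sin θ * Real.sin θ|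
        ≤ |Real.cos θ * Real.cos θ| + |Real.sin θ * Real.sin θ| := abs_sub _ _
      _ ≤ 2 := by linarith
  have hp : 0 ≤ α ^ 2 / (2 * s ^ 3) := by positivity
  have hq : 0 ≤ 4 * α / s ^ 2 := by positivity
  have hr : 0 ≤ c * α / s ^ 2 := by positivity
  have e1 : |α ^ 2 / (2 * s ^ 3) * (Real.cos θ * Real.cos θ - Real.sin θ * Real.sin θ)| ≤ α ^ 2 / (2 * s ^ 3) * 2 := by
    rw [abs_mul, abs_of_nonneg hp]; exact mul_le_mul_of_nonneg_left hd hp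
  have e2 : |4 * α / s ^ 2 * Real.cos θ| ≤ 4 * α / s ^ 2 := by
    rw [abs_mul, abs_of_nonneg hq]; exact mul_le_of_le_one_right hq hC
  have e3 : |c * α / s ^ 2 * Real.sin θ| ≤ c * α / s ^ 2 := by
    rw [abs_mul, abs_of_nonneg hr]; exact mul_le_of_le_one_right hr hS
  calc |α ^ 2 / (2 * s ^ 3) * (Real.cos θ * Real.cos θ - Real.sin θ * Real.sin θ) + 4 * α / s ^ 2 * Real.cos θ
        + c * α / s ^ 2 * Real.sin θ|
      ≤ |α ^ 2 / (2 * s ^ 3) * (Real.cos θ * Real.cos θ - Real.sin θ * Real.sin θ) + 4 * α / s ^ 2 * Real.cos θ|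
          + |c * α / s ^ 2 * Real.sin θ| := abs_add_le _ _
    _ ≤ (|α ^ 2 / (2 * s ^ 3) * (Real.cos θ * Real.cos θ - Real.sin θ * Real.sin θ)| + |4 * α / s ^ 2 * Real.cos θ|)
          + |c * α / s ^ 2 * Real.sin θ| := by gcongr; exact abs_add_le _ _
    _ ≤ α ^ 2 / (2 * s ^ 3) + 4 * α / s ^ 2 + c * α / s ^ 2 + α ^ 2 / (2 * s ^ 3) := by linarith

/-- The floor is monotone along the ray: `tail2Floor(T) ≤ w(θ)` for `θ ≥ T > 0` (non-negative `s, α, c`).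
[cite: Freidberg2014, §12.6.2 eq. (12.97)] (calculus bookkeeping for its Liouville normal form; ours) -/
theorem tail2Floor_le {s α c T θ : ℝ} (hs : 0 < s) (hα : 0 ≤ α) (hc : 0 ≤ c) (hT : 0 < T) (hθ : T ≤ θ) :
    tail2Floor s α c T ≤ tail2Amplitude s α c θ := by
  have hθpos : 0 < θ := hT.trans_le hθ
  have hκ : 0 ≤ α / s ^ 2 := by positivity
  have hM : 0 ≤ tail2M s α c := by unfold tail2M; positivity
  have hN := abs_tail2N_le (θ := θ) hs hα hc
  have hNlo : -tail2M s α c ≤ tail2N s α c θ := by linarith [neg_abs_le (tail2N s α c θ)]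
  -- term by term
  have t1 : c / θ ≤ c / T := div_le_div_of_nonneg_left hc hT hθ
  have t2 : α / s ^ 2 * (Real.cos θ / θ ^ 2) ≥ -(α / s ^ 2 / T ^ 2) := by
    have hcos : -1 ≤ Real.cos θ := Real.neg_one_le_cos θ
    have hθ2 : 0 < θ ^ 2 := by positivity
    have hT2 : T ^ 2 ≤ θ ^ 2 := pow_le_pow_left₀ hT.le hθ 2
    have a1 : Real.cos θ / θ ^ 2 ≥ -1 / θ ^ 2 := by
      exact div_le_div_of_nonneg_right hcos hθ2.le
    have a2 : -1 / θ ^ 2 ≥ -1 / T ^ 2 := by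
      rw [ge_iff_le, neg_div, neg_div, neg_le_neg_iff]
      exact div_le_div_of_nonneg_left zero_le_one (by positivity) hT2
    have a3 : α / s ^ 2 * (Real.cos θ / θ ^ 2) ≥ α / s ^ 2 * (-1 / T ^ 2) :=
      mul_le_mul_of_nonneg_left (a2.le.trans a1.le) hκ
    have a4 : α / s ^ 2 * (-1 / T ^ 2) = -(α / s ^ 2 / T ^ 2) := by ring
    linarith
  have t3 : tail2N s α c θ / θ ^ 3 ≥ -(tail2M s α c / T ^ 3) := by
    have hθ3 : 0 < θ ^ 3 := by positivity
    have hT3 : T ^ 3 ≤ θ ^ 3 := pow_le_pow_left₀ hT.le hθ 3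
    have a1 : tail2N s α c θ / θ ^ 3 ≥ -tail2M s α c / θ ^ 3 := div_le_div_of_nonneg_right hNlo hθ3.le
    have a2 : -tail2M s α c / θ ^ 3 ≥ -tail2M s α c / T ^ 3 := by
      rw [ge_iff_le, neg_div, neg_div, neg_le_neg_iff]
      exact div_le_div_of_nonneg_left hM (by positivity) hT3
    have a3 : -tail2M s α c / T ^ 3 = -(tail2M s α c / T ^ 3) := by ring
    linarith
  unfold tail2Floor tail2Amplitude
  linarith

/-- The slope bound AT the junction point: `w′(T) ≤ tail2Slope(T)`. [cite: Freidberg2014, §12.6.2 eq. (12.97)] (calculus bookkeeping for its Liouville normal form; ours) -/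
theorem tail2AmplitudeDeriv_le {s α c T : ℝ} (hs : 0 < s) (hα : 0 ≤ α) (hc : 0 ≤ c) (hT : 0 < T) :
    tail2AmplitudeDeriv s α c T ≤ tail2Slope s α c T := by
  have hκ : 0 ≤ α / s ^ 2 := by positivity
  have hM : 0 ≤ tail2M s α c := by unfold tail2M; positivity
  have hT2 : 0 < T ^ 2 := by positivity
  have hT3 : 0 < T ^ 3 := by positivity
  have hT4 : 0 < T ^ 4 := by positivity
  have hN := abs_tail2N_le (θ := T) hs hα hc
  have hN1 := abs_tail2N1_le (θ := T) hs hα hc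
  -- oscillatory κ-part: −sin/T² − 2cos/T³ ≤ 1/T² + 2/T³ = (T+2)/T³
  have o1 : -Real.sin T / T ^ 2 ≤ 1 / T ^ 2 :=
    div_le_div_of_nonneg_right (by linarith [Real.neg_one_le_sin T]) hT2.le
  have o2 : -(2 * Real.cos T / T ^ 3) ≤ 2 / T ^ 3 := by
    rw [← neg_div]; exact div_le_div_of_nonneg_right (by linarith [Real.neg_one_le_cos T]) hT3.le
  have o3 : α / s ^ 2 * (-Real.sin T / T ^ 2 - 2 * Real.cos T / T ^ 3) ≤ α / s ^ 2 * (T + 2) / T ^ 3 := by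
    have e : α / s ^ 2 * (T + 2) / T ^ 3 = α / s ^ 2 * (1 / T ^ 2 + 2 / T ^ 3) := by field_simp
    rw [e]; exact mul_le_mul_of_nonneg_left (by linarith) hκ
  have n1 : tail2N1 s α c T / T ^ 3 ≤ (tail2M s α c + α ^ 2 / (2 * s ^ 3)) / T ^ 3 :=
    div_le_div_of_nonneg_right ((le_abs_self _).trans hN1) hT3.le
  have n0 : -(3 * tail2N s α c T / T ^ 4) ≤ 3 * tail2M s α c / T ^ 4 := by
    rw [← neg_div]
    apply div_le_div_of_nonneg_right _ hT4.le
    linarith [neg_abs_le (tail2N s α c T)]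
  unfold tail2AmplitudeDeriv tail2Slope
  linarith

/-- THE JUNCTION NUMBER: `w′(T)/w(T) ≤ tail2Slope/tail2Floor` when the floor is positive. [cite: Hartman2002, Ch. XI §6
Thm. 6.2] (junction of two supersolutions) -/
theorem tail2_logDeriv_le {s α c T : ℝ} (hs : 0 < s) (hα : 0 ≤ α) (hc : 0 ≤ c) (hT : 0 < T)
    (hfloor : 0 < tail2Floor s α c T) :
    tail2AmplitudeDeriv s α c T / tail2Amplitude s α c T ≤ tail2Slope s α c T / tail2Floor s α c T := by
  have hw : tail2Floor s α c T ≤ tail2Amplitude s α c T := tail2Floor_le hs hα hc hT le_rfl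
  have hwpos : 0 < tail2Amplitude s α c T := hfloor.trans_le hw
  have hd : tail2AmplitudeDeriv s α c T ≤ tail2Slope s α c T := tail2AmplitudeDeriv_le hs hα hc hT
  have hslope : 0 ≤ tail2Slope s α c T := by
    unfold tail2Slope tail2M; positivity
  rcases le_or_gt 0 (tail2AmplitudeDeriv s α c T) with hpos | hneg
  · calc tail2AmplitudeDeriv s α c T / tail2Amplitude s α c T
        ≤ tail2Slope s α c T / tail2Amplitude s α c T := div_le_div_of_nonneg_right hd hwpos.le
      _ ≤ tail2Slope s α c T / tail2Floor s α c T := div_le_div_of_nonneg_left hslope hfloor hw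
  · have : tail2AmplitudeDeriv s α c T / tail2Amplitude s α c T < 0 := div_neg_of_neg_of_pos hneg hwpos
    have : 0 ≤ tail2Slope s α c T / tail2Floor s α c T := div_nonneg hslope hfloor.le
    linarith

/-! ## §6.3 The residual expansion `2s³θ⁵·residual = −4cs⁷θ⁶ + Σ_{k ≤ 5} tail2Coeffₖ θ^k` and its majorant -/

/-- `|S^a C^b| ≤ 1` for `|S|, |C| ≤ 1`. [folklore] -/
private lemma trig_abs_le' {S C : ℝ} (hS : |S| ≤ 1) (hC : |C| ≤ 1) (a b : ℕ) : |S ^ a * C ^ b| ≤ 1 := by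
  rw [abs_mul, abs_pow, abs_pow]
  exact mul_le_one₀ (pow_le_one₀ (abs_nonneg _) hS) (by positivity) (pow_le_one₀ (abs_nonneg _) hC)

/-- A trigonometric monomial times a coefficient is bounded by the coefficient's absolute value. [folklore] -/
private lemma cterm_abs_le' {m τ : ℝ} (hτ : |τ| ≤ 1) : m * τ ≤ |m| := by
  have h1 : m * τ ≤ |m * τ| := le_abs_self _
  have h2 : |m * τ| ≤ |m| := by
    rw [abs_mul]; exact mul_le_of_le_one_right (abs_nonneg m) hτ
  exact h1.trans h2

/-- Scaling of a majorant monomial from `T` to `θ ≥ T`: `m θ^k ≤ (θ/T)⁶ · m T^k` for `k ≤ 6`. [folklore] -/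
private lemma scale_term6 {m θ T : ℝ} (k : ℕ) (hk : k ≤ 6) (hm : 0 ≤ m) (hT : 0 < T) (hθ : T ≤ θ) :
    m * θ ^ k ≤ (θ / T) ^ 6 * (m * T ^ k) := by
  have hρ : 1 ≤ θ / T := by rwa [le_div_iff₀ hT, one_mul]
  have h1 : θ ^ k = (θ / T) ^ k * T ^ k := by rw [← mul_pow, div_mul_cancel₀ θ hT.ne']
  have h2 : (θ / T) ^ k ≤ (θ / T) ^ 6 := pow_le_pow_right₀ hρ hk
  rw [h1]
  have h3 : 0 ≤ m * T ^ k := mul_nonneg hm (pow_nonneg hT.le k)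
  nlinarith

/-- Coefficient of `θ^5` in the expansion `2s³θ⁵·residual` of the corrected tail amplitude (grouped by trigonometric
monomial `S^a C^b`, `S = sin θ`, `C = cos θ`). [cite: Freidberg2014, §12.6.2 eq. (12.97)] (bookkeeping ours, checked by `ring`) -/
def tail2Coeff5 (s α c S C : ℝ) : ℝ :=
  (-(2 : ℝ) * (s ^ 5)) * (S ^ 0 * C ^ 0)
  + (-(2 : ℝ) * (s ^ 3 * α) + (4 : ℝ) * (s ^ 4 * α) - (36 : ℝ) * (s ^ 5 * α)) * (S ^ 0 * C ^ 1)
  + (-(6 : ℝ) * (s ^ 4 * α ^ 2)) * (S ^ 0 * C ^ 2)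
  + (-(12 : ℝ) * (s ^ 5 * α * c) + (16 : ℝ) * (s ^ 6 * α * c)) * (S ^ 1 * C ^ 0)
  + (-(4 : ℝ) * (s ^ 4 * α ^ 2 * c)) * (S ^ 1 * C ^ 1)
  + ((6 : ℝ) * (s ^ 4 * α ^ 2)) * (S ^ 2 * C ^ 0)
  + ((6 : ℝ) * (s ^ 3 * α ^ 3)) * (S ^ 2 * C ^ 1)

/-- Coefficient of `θ^4` in the expansion `2s³θ⁵·residual` of the corrected tail amplitude (grouped by trigonometric
monomial `S^a C^b`, `S = sin θ`, `C = cos θ`). [cite: Freidberg2014, §12.6.2 eq. (12.97)] (bookkeeping ours, checked by `ring`) -/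
def tail2Coeff4 (s α c S C : ℝ) : ℝ :=
  (-(6 : ℝ) * (s ^ 5 * c)) * (S ^ 0 * C ^ 0)
  + ((2 : ℝ) * (s ^ 3 * α * c) - (4 : ℝ) * (s ^ 4 * α * c) - (24 : ℝ) * (s ^ 5 * α * c)) * (S ^ 0 * C ^ 1)
  + ((96 : ℝ) * (s ^ 5 * α)) * (S ^ 1 * C ^ 0)
  + ((8 : ℝ) * (s ^ 3 * α ^ 2) + (156 : ℝ) * (s ^ 4 * α ^ 2)) * (S ^ 1 * C ^ 1)
  + (-(3 : ℝ) * (s ^ 2 * α ^ 3) + (24 : ℝ) * (s ^ 3 * α ^ 3)) * (S ^ 1 * C ^ 2)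
  + ((48 : ℝ) * (s ^ 4 * α ^ 2 * c) - (24 : ℝ) * (s ^ 5 * α ^ 2 * c)) * (S ^ 2 * C ^ 0)
  + ((10 : ℝ) * (s ^ 3 * α ^ 3 * c)) * (S ^ 2 * C ^ 1)
  + (-(24 : ℝ) * (s ^ 3 * α ^ 3)) * (S ^ 3 * C ^ 0)
  + (-(16 : ℝ) * (s ^ 2 * α ^ 4)) * (S ^ 3 * C ^ 1)

/-- Coefficient of `θ^3` in the expansion `2s³θ⁵·residual` of the corrected tail amplitude (grouped by trigonometric
monomial `S^a C^b`, `S = sin θ`, `C = cos θ`). [cite: Freidberg2014, §12.6.2 eq. (12.97)] (bookkeeping ours, checked by `ring`) -/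
def tail2Coeff3 (s α c S C : ℝ) : ℝ :=
  (-(2 : ℝ) * (s * α) - (74 : ℝ) * (s ^ 3 * α)) * (S ^ 0 * C ^ 1)
  + ((2 : ℝ) * (s * α ^ 2) - (8 : ℝ) * (s ^ 2 * α ^ 2)) * (S ^ 0 * C ^ 2)
  + (-(2 : ℝ) * (s * α ^ 3)) * (S ^ 0 * C ^ 3)
  + (-(24 : ℝ) * (s ^ 3 * α * c) + (16 : ℝ) * (s ^ 4 * α * c)) * (S ^ 1 * C ^ 0)
  + (-(8 : ℝ) * (s ^ 2 * α ^ 2 * c) + (96 : ℝ) * (s ^ 4 * α ^ 2 * c)) * (S ^ 1 * C ^ 1)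
  + ((4 : ℝ) * (s ^ 2 * α ^ 3 * c)) * (S ^ 1 * C ^ 2)
  + ((12 : ℝ) * (s ^ 2 * α ^ 2) - (384 : ℝ) * (s ^ 4 * α ^ 2)) * (S ^ 2 * C ^ 0)
  + ((12 : ℝ) * (s * α ^ 3) - (16 : ℝ) * (s ^ 2 * α ^ 3) - (264 : ℝ) * (s ^ 3 * α ^ 3)) * (S ^ 2 * C ^ 1)
  + (-(36 : ℝ) * (s ^ 2 * α ^ 4)) * (S ^ 2 * C ^ 2)
  + (-(72 : ℝ) * (s ^ 3 * α ^ 3 * c) + (16 : ℝ) * (s ^ 4 * α ^ 3 * c)) * (S ^ 3 * C ^ 0)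
  + (-(8 : ℝ) * (s ^ 2 * α ^ 4 * c)) * (S ^ 3 * C ^ 1)
  + ((36 : ℝ) * (s ^ 2 * α ^ 4)) * (S ^ 4 * C ^ 0)
  + ((14 : ℝ) * (s * α ^ 5)) * (S ^ 4 * C ^ 1)

/-- Coefficient of `θ^2` in the expansion `2s³θ⁵·residual` of the corrected tail amplitude (grouped by trigonometric
monomial `S^a C^b`, `S = sin θ`, `C = cos θ`). [cite: Freidberg2014, §12.6.2 eq. (12.97)] (bookkeeping ours, checked by `ring`) -/
def tail2Coeff2 (s α c S C : ℝ) : ℝ :=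
  (-(4 : ℝ) * (s ^ 3 * c)) * (S ^ 0 * C ^ 0)
  + ((2 : ℝ) * (s * α * c) - (46 : ℝ) * (s ^ 3 * α * c)) * (S ^ 0 * C ^ 1)
  + (-(2 : ℝ) * (s * α ^ 2 * c) - (4 : ℝ) * (s ^ 2 * α ^ 2 * c)) * (S ^ 0 * C ^ 2)
  + ((2 : ℝ) * (s * α ^ 3 * c)) * (S ^ 0 * C ^ 3)
  + ((184 : ℝ) * (s ^ 3 * α)) * (S ^ 1 * C ^ 0)
  + (-(4 : ℝ) * (α ^ 2) + (8 : ℝ) * (s * α ^ 2) + (183 : ℝ) * (s ^ 2 * α ^ 2)) * (S ^ 1 * C ^ 1)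
  + ((1 : ℝ) * (α ^ 3) + (18 : ℝ) * (s * α ^ 3)) * (S ^ 1 * C ^ 2)
  + (-(1 : ℝ) * (α ^ 4)) * (S ^ 1 * C ^ 3)
  + ((48 : ℝ) * (s ^ 2 * α ^ 2 * c) - (8 : ℝ) * (s ^ 3 * α ^ 2 * c)) * (S ^ 2 * C ^ 0)
  + ((4 : ℝ) * (s * α ^ 3 * c) - (144 : ℝ) * (s ^ 3 * α ^ 3 * c)) * (S ^ 2 * C ^ 1)
  + (-(2 : ℝ) * (s * α ^ 4 * c)) * (S ^ 2 * C ^ 2)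
  + (-(24 : ℝ) * (s * α ^ 3) + (576 : ℝ) * (s ^ 3 * α ^ 3)) * (S ^ 3 * C ^ 0)
  + (-(8 : ℝ) * (α ^ 4) + (8 : ℝ) * (s * α ^ 4) + (216 : ℝ) * (s ^ 2 * α ^ 4)) * (S ^ 3 * C ^ 1)
  + ((1 : ℝ) * (α ^ 5) + (24 : ℝ) * (s * α ^ 5)) * (S ^ 3 * C ^ 2)
  + ((48 : ℝ) * (s ^ 2 * α ^ 4 * c) - (4 : ℝ) * (s ^ 3 * α ^ 4 * c)) * (S ^ 4 * C ^ 0)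
  + ((2 : ℝ) * (s * α ^ 5 * c)) * (S ^ 4 * C ^ 1)
  + (-(24 : ℝ) * (s * α ^ 5)) * (S ^ 5 * C ^ 0)
  + (-(4 : ℝ) * (α ^ 6)) * (S ^ 5 * C ^ 1)

/-- Coefficient of `θ^1` in the expansion `2s³θ⁵·residual` of the corrected tail amplitude (grouped by trigonometric
monomial `S^a C^b`, `S = sin θ`, `C = cos θ`). [cite: Freidberg2014, §12.6.2 eq. (12.97)] (bookkeeping ours, checked by `ring`) -/
def tail2Coeff1 (s α c S C : ℝ) : ℝ :=
  (-(36 : ℝ) * (s * α)) * (S ^ 0 * C ^ 1)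
  + (-(6 : ℝ) * (α ^ 2)) * (S ^ 0 * C ^ 2)
  + (-(12 : ℝ) * (s * α * c)) * (S ^ 1 * C ^ 0)
  + ((96 : ℝ) * (s ^ 2 * α ^ 2 * c)) * (S ^ 1 * C ^ 1)
  + ((6 : ℝ) * (α ^ 2) - (384 : ℝ) * (s ^ 2 * α ^ 2)) * (S ^ 2 * C ^ 0)
  + (-(120 : ℝ) * (s * α ^ 3)) * (S ^ 2 * C ^ 1)
  + (-(12 : ℝ) * (α ^ 4)) * (S ^ 2 * C ^ 2)
  + (-(24 : ℝ) * (s * α ^ 3 * c)) * (S ^ 3 * C ^ 0)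
  + ((96 : ℝ) * (s ^ 2 * α ^ 4 * c)) * (S ^ 3 * C ^ 1)
  + ((12 : ℝ) * (α ^ 4) - (384 : ℝ) * (s ^ 2 * α ^ 4)) * (S ^ 4 * C ^ 0)
  + (-(84 : ℝ) * (s * α ^ 5)) * (S ^ 4 * C ^ 1)
  + (-(6 : ℝ) * (α ^ 6)) * (S ^ 4 * C ^ 2)
  + (-(12 : ℝ) * (s * α ^ 5 * c)) * (S ^ 5 * C ^ 0)
  + ((6 : ℝ) * (α ^ 6)) * (S ^ 6 * C ^ 0)

/-- Coefficient of `θ^0` in the expansion `2s³θ⁵·residual` of the corrected tail amplitude (grouped by trigonometric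
monomial `S^a C^b`, `S = sin θ`, `C = cos θ`). [cite: Freidberg2014, §12.6.2 eq. (12.97)] (bookkeeping ours, checked by `ring`) -/
def tail2Coeff0 (s α c S C : ℝ) : ℝ :=
  (-(24 : ℝ) * (s * α * c)) * (S ^ 0 * C ^ 1)
  + ((96 : ℝ) * (s * α)) * (S ^ 1 * C ^ 0)
  + ((12 : ℝ) * (α ^ 2)) * (S ^ 1 * C ^ 1)
  + (-(48 : ℝ) * (s * α ^ 3 * c)) * (S ^ 2 * C ^ 1)
  + ((192 : ℝ) * (s * α ^ 3)) * (S ^ 3 * C ^ 0)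
  + ((24 : ℝ) * (α ^ 4)) * (S ^ 3 * C ^ 1)
  + (-(24 : ℝ) * (s * α ^ 5 * c)) * (S ^ 4 * C ^ 1)
  + ((96 : ℝ) * (s * α ^ 5)) * (S ^ 5 * C ^ 0)
  + ((12 : ℝ) * (α ^ 6)) * (S ^ 5 * C ^ 1)

/-- Majorant of `tail2Coeff5` for `|S|, |C| ≤ 1` (absolute values of the coefficients; favourable trigonometry-free
monomials dropped). [cite: Freidberg2014, §12.6.2 eq. (12.97)] (bookkeeping ours) -/
def tail2Maj5 (s α c : ℝ) : ℝ :=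
  |-(2 : ℝ) * (s ^ 3 * α) + (4 : ℝ) * (s ^ 4 * α) - (36 : ℝ) * (s ^ 5 * α)|
  + |-(6 : ℝ) * (s ^ 4 * α ^ 2)|
  + |-(12 : ℝ) * (s ^ 5 * α * c) + (16 : ℝ) * (s ^ 6 * α * c)|
  + |-(4 : ℝ) * (s ^ 4 * α ^ 2 * c)|
  + |(6 : ℝ) * (s ^ 4 * α ^ 2)|
  + |(6 : ℝ) * (s ^ 3 * α ^ 3)|

/-- Majorant of `tail2Coeff4` for `|S|, |C| ≤ 1` (absolute values of the coefficients; favourable trigonometry-free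
monomials dropped). [cite: Freidberg2014, §12.6.2 eq. (12.97)] (bookkeeping ours) -/
def tail2Maj4 (s α c : ℝ) : ℝ :=
  |(2 : ℝ) * (s ^ 3 * α * c) - (4 : ℝ) * (s ^ 4 * α * c) - (24 : ℝ) * (s ^ 5 * α * c)|
  + |(96 : ℝ) * (s ^ 5 * α)|
  + |(8 : ℝ) * (s ^ 3 * α ^ 2) + (156 : ℝ) * (s ^ 4 * α ^ 2)|
  + |-(3 : ℝ) * (s ^ 2 * α ^ 3) + (24 : ℝ) * (s ^ 3 * α ^ 3)|
  + |(48 : ℝ) * (s ^ 4 * α ^ 2 * c) - (24 : ℝ) * (s ^ 5 * α ^ 2 * c)|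
  + |(10 : ℝ) * (s ^ 3 * α ^ 3 * c)|
  + |-(24 : ℝ) * (s ^ 3 * α ^ 3)|
  + |-(16 : ℝ) * (s ^ 2 * α ^ 4)|

/-- Majorant of `tail2Coeff3` for `|S|, |C| ≤ 1` (absolute values of the coefficients; favourable trigonometry-free
monomials dropped). [cite: Freidberg2014, §12.6.2 eq. (12.97)] (bookkeeping ours) -/
def tail2Maj3 (s α c : ℝ) : ℝ :=
  |-(2 : ℝ) * (s * α) - (74 : ℝ) * (s ^ 3 * α)|
  + |(2 : ℝ) * (s * α ^ 2) - (8 : ℝ) * (s ^ 2 * α ^ 2)|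
  + |-(2 : ℝ) * (s * α ^ 3)|
  + |-(24 : ℝ) * (s ^ 3 * α * c) + (16 : ℝ) * (s ^ 4 * α * c)|
  + |-(8 : ℝ) * (s ^ 2 * α ^ 2 * c) + (96 : ℝ) * (s ^ 4 * α ^ 2 * c)|
  + |(4 : ℝ) * (s ^ 2 * α ^ 3 * c)|
  + |(12 : ℝ) * (s ^ 2 * α ^ 2) - (384 : ℝ) * (s ^ 4 * α ^ 2)|
  + |(12 : ℝ) * (s * α ^ 3) - (16 : ℝ) * (s ^ 2 * α ^ 3) - (264 : ℝ) * (s ^ 3 * α ^ 3)|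
  + |-(36 : ℝ) * (s ^ 2 * α ^ 4)|
  + |-(72 : ℝ) * (s ^ 3 * α ^ 3 * c) + (16 : ℝ) * (s ^ 4 * α ^ 3 * c)|
  + |-(8 : ℝ) * (s ^ 2 * α ^ 4 * c)|
  + |(36 : ℝ) * (s ^ 2 * α ^ 4)|
  + |(14 : ℝ) * (s * α ^ 5)|

/-- Majorant of `tail2Coeff2` for `|S|, |C| ≤ 1` (absolute values of the coefficients; favourable trigonometry-free
monomials dropped). [cite: Freidberg2014, §12.6.2 eq. (12.97)] (bookkeeping ours) -/
def tail2Maj2 (s α c : ℝ) : ℝ :=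
  |(2 : ℝ) * (s * α * c) - (46 : ℝ) * (s ^ 3 * α * c)|
  + |-(2 : ℝ) * (s * α ^ 2 * c) - (4 : ℝ) * (s ^ 2 * α ^ 2 * c)|
  + |(2 : ℝ) * (s * α ^ 3 * c)|
  + |(184 : ℝ) * (s ^ 3 * α)|
  + |-(4 : ℝ) * (α ^ 2) + (8 : ℝ) * (s * α ^ 2) + (183 : ℝ) * (s ^ 2 * α ^ 2)|
  + |(1 : ℝ) * (α ^ 3) + (18 : ℝ) * (s * α ^ 3)|
  + |-(1 : ℝ) * (α ^ 4)|
  + |(48 : ℝ) * (s ^ 2 * α ^ 2 * c) - (8 : ℝ) * (s ^ 3 * α ^ 2 * c)|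
  + |(4 : ℝ) * (s * α ^ 3 * c) - (144 : ℝ) * (s ^ 3 * α ^ 3 * c)|
  + |-(2 : ℝ) * (s * α ^ 4 * c)|
  + |-(24 : ℝ) * (s * α ^ 3) + (576 : ℝ) * (s ^ 3 * α ^ 3)|
  + |-(8 : ℝ) * (α ^ 4) + (8 : ℝ) * (s * α ^ 4) + (216 : ℝ) * (s ^ 2 * α ^ 4)|
  + |(1 : ℝ) * (α ^ 5) + (24 : ℝ) * (s * α ^ 5)|
  + |(48 : ℝ) * (s ^ 2 * α ^ 4 * c) - (4 : ℝ) * (s ^ 3 * α ^ 4 * c)|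
  + |(2 : ℝ) * (s * α ^ 5 * c)|
  + |-(24 : ℝ) * (s * α ^ 5)|
  + |-(4 : ℝ) * (α ^ 6)|

/-- Majorant of `tail2Coeff1` for `|S|, |C| ≤ 1` (absolute values of the coefficients; favourable trigonometry-free
monomials dropped). [cite: Freidberg2014, §12.6.2 eq. (12.97)] (bookkeeping ours) -/
def tail2Maj1 (s α c : ℝ) : ℝ :=
  |-(36 : ℝ) * (s * α)|
  + |-(6 : ℝ) * (α ^ 2)|
  + |-(12 : ℝ) * (s * α * c)|
  + |(96 : ℝ) * (s ^ 2 * α ^ 2 * c)|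
  + |(6 : ℝ) * (α ^ 2) - (384 : ℝ) * (s ^ 2 * α ^ 2)|
  + |-(120 : ℝ) * (s * α ^ 3)|
  + |-(12 : ℝ) * (α ^ 4)|
  + |-(24 : ℝ) * (s * α ^ 3 * c)|
  + |(96 : ℝ) * (s ^ 2 * α ^ 4 * c)|
  + |(12 : ℝ) * (α ^ 4) - (384 : ℝ) * (s ^ 2 * α ^ 4)|
  + |-(84 : ℝ) * (s * α ^ 5)|
  + |-(6 : ℝ) * (α ^ 6)|
  + |-(12 : ℝ) * (s * α ^ 5 * c)|
  + |(6 : ℝ) * (α ^ 6)|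

/-- Majorant of `tail2Coeff0` for `|S|, |C| ≤ 1` (absolute values of the coefficients; favourable trigonometry-free
monomials dropped). [cite: Freidberg2014, §12.6.2 eq. (12.97)] (bookkeeping ours) -/
def tail2Maj0 (s α c : ℝ) : ℝ :=
  |-(24 : ℝ) * (s * α * c)|
  + |(96 : ℝ) * (s * α)|
  + |(12 : ℝ) * (α ^ 2)|
  + |-(48 : ℝ) * (s * α ^ 3 * c)|
  + |(192 : ℝ) * (s * α ^ 3)|
  + |(24 : ℝ) * (α ^ 4)|
  + |-(24 : ℝ) * (s * α ^ 5 * c)|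
  + |(96 : ℝ) * (s * α ^ 5)|
  + |(12 : ℝ) * (α ^ 6)|

/-- THE EXACT EXPANSION `2s³θ⁵·[(1+Λ²)²w″ + (α cos θ (1+Λ²) − ŝ²)w] = −4cs⁷θ⁶ + Σ_{k=0}^{5} tail2Coeffₖ(sin θ, cos θ) θ^k`
(100 signed monomials besides the leading one; NO oscillatory `θ⁶` monomial — the point of the correction).
[cite: Freidberg2014, §12.6.2 eq. (12.97)] (residual of an explicit trial amplitude; bookkeeping ours) -/
def tail2Expansion (s α c S C θ : ℝ) : ℝ :=
  -((4 : ℝ) * (s ^ 7 * c)) * θ ^ 6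
  + tail2Coeff5 s α c S C * θ ^ 5
  + tail2Coeff4 s α c S C * θ ^ 4
  + tail2Coeff3 s α c S C * θ ^ 3
  + tail2Coeff2 s α c S C * θ ^ 2
  + tail2Coeff1 s α c S C * θ ^ 1
  + tail2Coeff0 s α c S C * θ ^ 0

/-- THE MAJORANT `Σₖ tail2Majₖ · θ^k`. [cite: Freidberg2014, §12.6.2 eq. (12.97)] (bookkeeping ours) -/
def tail2Majorant (s α c θ : ℝ) : ℝ :=
  tail2Maj5 s α c * θ ^ 5
  + tail2Maj4 s α c * θ ^ 4
  + tail2Maj3 s α c * θ ^ 3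
  + tail2Maj2 s α c * θ ^ 2
  + tail2Maj1 s α c * θ ^ 1
  + tail2Maj0 s α c * θ ^ 0

/-- `tail2Coeff5 ≤ tail2Maj5` for `|S|, |C| ≤ 1` and non-negative parameters. [folklore] -/
private lemma tail2Coeff5_le {s α c S C : ℝ} (_hs : 0 ≤ s) (_hα : 0 ≤ α) (_hc : 0 ≤ c) (hS : |S| ≤ 1)
    (hC : |C| ≤ 1) : tail2Coeff5 s α c S C ≤ tail2Maj5 s α c := by
  have h0 : (-(2 : ℝ) * (s ^ 5)) * (S ^ 0 * C ^ 0) ≤ 0 := by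
    simp only [pow_zero, mul_one]; linarith [(by positivity : (0:ℝ) ≤ (2 : ℝ) * (s ^ 5))]
  have h1 : (-(2 : ℝ) * (s ^ 3 * α) + (4 : ℝ) * (s ^ 4 * α) - (36 : ℝ) * (s ^ 5 * α)) * (S ^ 0 * C ^ 1) ≤ |-(2 : ℝ) * (s ^ 3 * α) + (4 : ℝ) * (s ^ 4 * α) - (36 : ℝ) * (s ^ 5 * α)| :=
    cterm_abs_le' (trig_abs_le' hS hC 0 1)
  have h2 : (-(6 : ℝ) * (s ^ 4 * α ^ 2)) * (S ^ 0 * C ^ 2) ≤ |-(6 : ℝ) * (s ^ 4 * α ^ 2)| :=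
    cterm_abs_le' (trig_abs_le' hS hC 0 2)
  have h3 : (-(12 : ℝ) * (s ^ 5 * α * c) + (16 : ℝ) * (s ^ 6 * α * c)) * (S ^ 1 * C ^ 0) ≤ |-(12 : ℝ) * (s ^ 5 * α * c) + (16 : ℝ) * (s ^ 6 * α * c)| :=
    cterm_abs_le' (trig_abs_le' hS hC 1 0)
  have h4 : (-(4 : ℝ) * (s ^ 4 * α ^ 2 * c)) * (S ^ 1 * C ^ 1) ≤ |-(4 : ℝ) * (s ^ 4 * α ^ 2 * c)| :=
    cterm_abs_le' (trig_abs_le' hS hC 1 1)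
  have h5 : ((6 : ℝ) * (s ^ 4 * α ^ 2)) * (S ^ 2 * C ^ 0) ≤ |(6 : ℝ) * (s ^ 4 * α ^ 2)| :=
    cterm_abs_le' (trig_abs_le' hS hC 2 0)
  have h6 : ((6 : ℝ) * (s ^ 3 * α ^ 3)) * (S ^ 2 * C ^ 1) ≤ |(6 : ℝ) * (s ^ 3 * α ^ 3)| :=
    cterm_abs_le' (trig_abs_le' hS hC 2 1)
  unfold tail2Coeff5 tail2Maj5
  linarith [h0, h1, h2, h3, h4, h5, h6]

/-- `tail2Coeff4 ≤ tail2Maj4` for `|S|, |C| ≤ 1` and non-negative parameters. [folklore] -/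
private lemma tail2Coeff4_le {s α c S C : ℝ} (_hs : 0 ≤ s) (_hα : 0 ≤ α) (_hc : 0 ≤ c) (hS : |S| ≤ 1)
    (hC : |C| ≤ 1) : tail2Coeff4 s α c S C ≤ tail2Maj4 s α c := by
  have h0 : (-(6 : ℝ) * (s ^ 5 * c)) * (S ^ 0 * C ^ 0) ≤ 0 := by
    simp only [pow_zero, mul_one]; linarith [(by positivity : (0:ℝ) ≤ (6 : ℝ) * (s ^ 5 * c))]
  have h1 : ((2 : ℝ) * (s ^ 3 * α * c) - (4 : ℝ) * (s ^ 4 * α * c) - (24 : ℝ) * (s ^ 5 * α * c)) * (S ^ 0 * C ^ 1) ≤ |(2 : ℝ) * (s ^ 3 * α * c) - (4 : ℝ) * (s ^ 4 * α * c) - (24 : ℝ) * (s ^ 5 * α * c)| :=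
    cterm_abs_le' (trig_abs_le' hS hC 0 1)
  have h2 : ((96 : ℝ) * (s ^ 5 * α)) * (S ^ 1 * C ^ 0) ≤ |(96 : ℝ) * (s ^ 5 * α)| :=
    cterm_abs_le' (trig_abs_le' hS hC 1 0)
  have h3 : ((8 : ℝ) * (s ^ 3 * α ^ 2) + (156 : ℝ) * (s ^ 4 * α ^ 2)) * (S ^ 1 * C ^ 1) ≤ |(8 : ℝ) * (s ^ 3 * α ^ 2) + (156 : ℝ) * (s ^ 4 * α ^ 2)| :=
    cterm_abs_le' (trig_abs_le' hS hC 1 1)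
  have h4 : (-(3 : ℝ) * (s ^ 2 * α ^ 3) + (24 : ℝ) * (s ^ 3 * α ^ 3)) * (S ^ 1 * C ^ 2) ≤ |-(3 : ℝ) * (s ^ 2 * α ^ 3) + (24 : ℝ) * (s ^ 3 * α ^ 3)| :=
    cterm_abs_le' (trig_abs_le' hS hC 1 2)
  have h5 : ((48 : ℝ) * (s ^ 4 * α ^ 2 * c) - (24 : ℝ) * (s ^ 5 * α ^ 2 * c)) * (S ^ 2 * C ^ 0) ≤ |(48 : ℝ) * (s ^ 4 * α ^ 2 * c) - (24 : ℝ) * (s ^ 5 * α ^ 2 * c)| :=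
    cterm_abs_le' (trig_abs_le' hS hC 2 0)
  have h6 : ((10 : ℝ) * (s ^ 3 * α ^ 3 * c)) * (S ^ 2 * C ^ 1) ≤ |(10 : ℝ) * (s ^ 3 * α ^ 3 * c)| :=
    cterm_abs_le' (trig_abs_le' hS hC 2 1)
  have h7 : (-(24 : ℝ) * (s ^ 3 * α ^ 3)) * (S ^ 3 * C ^ 0) ≤ |-(24 : ℝ) * (s ^ 3 * α ^ 3)| :=
    cterm_abs_le' (trig_abs_le' hS hC 3 0)
  have h8 : (-(16 : ℝ) * (s ^ 2 * α ^ 4)) * (S ^ 3 * C ^ 1) ≤ |-(16 : ℝ) * (s ^ 2 * α ^ 4)| :=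
    cterm_abs_le' (trig_abs_le' hS hC 3 1)
  unfold tail2Coeff4 tail2Maj4
  linarith [h0, h1, h2, h3, h4, h5, h6, h7, h8]

/-- `tail2Coeff3 ≤ tail2Maj3` for `|S|, |C| ≤ 1` and non-negative parameters. [folklore] -/
private lemma tail2Coeff3_le {s α c S C : ℝ} (_hs : 0 ≤ s) (_hα : 0 ≤ α) (_hc : 0 ≤ c) (hS : |S| ≤ 1)
    (hC : |C| ≤ 1) : tail2Coeff3 s α c S C ≤ tail2Maj3 s α c := by
  have h0 : (-(2 : ℝ) * (s * α) - (74 : ℝ) * (s ^ 3 * α)) * (S ^ 0 * C ^ 1) ≤ |-(2 : ℝ) * (s * α) - (74 : ℝ) * (s ^ 3 * α)| :=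
    cterm_abs_le' (trig_abs_le' hS hC 0 1)
  have h1 : ((2 : ℝ) * (s * α ^ 2) - (8 : ℝ) * (s ^ 2 * α ^ 2)) * (S ^ 0 * C ^ 2) ≤ |(2 : ℝ) * (s * α ^ 2) - (8 : ℝ) * (s ^ 2 * α ^ 2)| :=
    cterm_abs_le' (trig_abs_le' hS hC 0 2)
  have h2 : (-(2 : ℝ) * (s * α ^ 3)) * (S ^ 0 * C ^ 3) ≤ |-(2 : ℝ) * (s * α ^ 3)| :=
    cterm_abs_le' (trig_abs_le' hS hC 0 3)
  have h3 : (-(24 : ℝ) * (s ^ 3 * α * c) + (16 : ℝ) * (s ^ 4 * α * c)) * (S ^ 1 * C ^ 0) ≤ |-(24 : ℝ) * (s ^ 3 * α * c) + (16 : ℝ) * (s ^ 4 * α * c)| :=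
    cterm_abs_le' (trig_abs_le' hS hC 1 0)
  have h4 : (-(8 : ℝ) * (s ^ 2 * α ^ 2 * c) + (96 : ℝ) * (s ^ 4 * α ^ 2 * c)) * (S ^ 1 * C ^ 1) ≤ |-(8 : ℝ) * (s ^ 2 * α ^ 2 * c) + (96 : ℝ) * (s ^ 4 * α ^ 2 * c)| :=
    cterm_abs_le' (trig_abs_le' hS hC 1 1)
  have h5 : ((4 : ℝ) * (s ^ 2 * α ^ 3 * c)) * (S ^ 1 * C ^ 2) ≤ |(4 : ℝ) * (s ^ 2 * α ^ 3 * c)| :=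
    cterm_abs_le' (trig_abs_le' hS hC 1 2)
  have h6 : ((12 : ℝ) * (s ^ 2 * α ^ 2) - (384 : ℝ) * (s ^ 4 * α ^ 2)) * (S ^ 2 * C ^ 0) ≤ |(12 : ℝ) * (s ^ 2 * α ^ 2) - (384 : ℝ) * (s ^ 4 * α ^ 2)| :=
    cterm_abs_le' (trig_abs_le' hS hC 2 0)
  have h7 : ((12 : ℝ) * (s * α ^ 3) - (16 : ℝ) * (s ^ 2 * α ^ 3) - (264 : ℝ) * (s ^ 3 * α ^ 3)) * (S ^ 2 * C ^ 1) ≤ |(12 : ℝ) * (s * α ^ 3) - (16 : ℝ) * (s ^ 2 * α ^ 3) - (264 : ℝ) * (s ^ 3 * α ^ 3)| :=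
    cterm_abs_le' (trig_abs_le' hS hC 2 1)
  have h8 : (-(36 : ℝ) * (s ^ 2 * α ^ 4)) * (S ^ 2 * C ^ 2) ≤ |-(36 : ℝ) * (s ^ 2 * α ^ 4)| :=
    cterm_abs_le' (trig_abs_le' hS hC 2 2)
  have h9 : (-(72 : ℝ) * (s ^ 3 * α ^ 3 * c) + (16 : ℝ) * (s ^ 4 * α ^ 3 * c)) * (S ^ 3 * C ^ 0) ≤ |-(72 : ℝ) * (s ^ 3 * α ^ 3 * c) + (16 : ℝ) * (s ^ 4 * α ^ 3 * c)| :=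
    cterm_abs_le' (trig_abs_le' hS hC 3 0)
  have h10 : (-(8 : ℝ) * (s ^ 2 * α ^ 4 * c)) * (S ^ 3 * C ^ 1) ≤ |-(8 : ℝ) * (s ^ 2 * α ^ 4 * c)| :=
    cterm_abs_le' (trig_abs_le' hS hC 3 1)
  have h11 : ((36 : ℝ) * (s ^ 2 * α ^ 4)) * (S ^ 4 * C ^ 0) ≤ |(36 : ℝ) * (s ^ 2 * α ^ 4)| :=
    cterm_abs_le' (trig_abs_le' hS hC 4 0)
  have h12 : ((14 : ℝ) * (s * α ^ 5)) * (S ^ 4 * C ^ 1) ≤ |(14 : ℝ) * (s * α ^ 5)| :=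
    cterm_abs_le' (trig_abs_le' hS hC 4 1)
  unfold tail2Coeff3 tail2Maj3
  linarith [h0, h1, h2, h3, h4, h5, h6, h7, h8, h9, h10, h11, h12]

/-- `tail2Coeff2 ≤ tail2Maj2` for `|S|, |C| ≤ 1` and non-negative parameters. [folklore] -/
private lemma tail2Coeff2_le {s α c S C : ℝ} (_hs : 0 ≤ s) (_hα : 0 ≤ α) (_hc : 0 ≤ c) (hS : |S| ≤ 1)
    (hC : |C| ≤ 1) : tail2Coeff2 s α c S C ≤ tail2Maj2 s α c := by
  have h0 : (-(4 : ℝ) * (s ^ 3 * c)) * (S ^ 0 * C ^ 0) ≤ 0 := by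
    simp only [pow_zero, mul_one]; linarith [(by positivity : (0:ℝ) ≤ (4 : ℝ) * (s ^ 3 * c))]
  have h1 : ((2 : ℝ) * (s * α * c) - (46 : ℝ) * (s ^ 3 * α * c)) * (S ^ 0 * C ^ 1) ≤ |(2 : ℝ) * (s * α * c) - (46 : ℝ) * (s ^ 3 * α * c)| :=
    cterm_abs_le' (trig_abs_le' hS hC 0 1)
  have h2 : (-(2 : ℝ) * (s * α ^ 2 * c) - (4 : ℝ) * (s ^ 2 * α ^ 2 * c)) * (S ^ 0 * C ^ 2) ≤ |-(2 : ℝ) * (s * α ^ 2 * c) - (4 : ℝ) * (s ^ 2 * α ^ 2 * c)| :=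
    cterm_abs_le' (trig_abs_le' hS hC 0 2)
  have h3 : ((2 : ℝ) * (s * α ^ 3 * c)) * (S ^ 0 * C ^ 3) ≤ |(2 : ℝ) * (s * α ^ 3 * c)| :=
    cterm_abs_le' (trig_abs_le' hS hC 0 3)
  have h4 : ((184 : ℝ) * (s ^ 3 * α)) * (S ^ 1 * C ^ 0) ≤ |(184 : ℝ) * (s ^ 3 * α)| :=
    cterm_abs_le' (trig_abs_le' hS hC 1 0)
  have h5 : (-(4 : ℝ) * (α ^ 2) + (8 : ℝ) * (s * α ^ 2) + (183 : ℝ) * (s ^ 2 * α ^ 2)) * (S ^ 1 * C ^ 1) ≤ |-(4 : ℝ) * (α ^ 2) + (8 : ℝ) * (s * α ^ 2) + (183 : ℝ) * (s ^ 2 * α ^ 2)| :=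
    cterm_abs_le' (trig_abs_le' hS hC 1 1)
  have h6 : ((1 : ℝ) * (α ^ 3) + (18 : ℝ) * (s * α ^ 3)) * (S ^ 1 * C ^ 2) ≤ |(1 : ℝ) * (α ^ 3) + (18 : ℝ) * (s * α ^ 3)| :=
    cterm_abs_le' (trig_abs_le' hS hC 1 2)
  have h7 : (-(1 : ℝ) * (α ^ 4)) * (S ^ 1 * C ^ 3) ≤ |-(1 : ℝ) * (α ^ 4)| :=
    cterm_abs_le' (trig_abs_le' hS hC 1 3)
  have h8 : ((48 : ℝ) * (s ^ 2 * α ^ 2 * c) - (8 : ℝ) * (s ^ 3 * α ^ 2 * c)) * (S ^ 2 * C ^ 0) ≤ |(48 : ℝ) * (s ^ 2 * α ^ 2 * c) - (8 : ℝ) * (s ^ 3 * α ^ 2 * c)| :=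
    cterm_abs_le' (trig_abs_le' hS hC 2 0)
  have h9 : ((4 : ℝ) * (s * α ^ 3 * c) - (144 : ℝ) * (s ^ 3 * α ^ 3 * c)) * (S ^ 2 * C ^ 1) ≤ |(4 : ℝ) * (s * α ^ 3 * c) - (144 : ℝ) * (s ^ 3 * α ^ 3 * c)| :=
    cterm_abs_le' (trig_abs_le' hS hC 2 1)
  have h10 : (-(2 : ℝ) * (s * α ^ 4 * c)) * (S ^ 2 * C ^ 2) ≤ |-(2 : ℝ) * (s * α ^ 4 * c)| :=
    cterm_abs_le' (trig_abs_le' hS hC 2 2)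
  have h11 : (-(24 : ℝ) * (s * α ^ 3) + (576 : ℝ) * (s ^ 3 * α ^ 3)) * (S ^ 3 * C ^ 0) ≤ |-(24 : ℝ) * (s * α ^ 3) + (576 : ℝ) * (s ^ 3 * α ^ 3)| :=
    cterm_abs_le' (trig_abs_le' hS hC 3 0)
  have h12 : (-(8 : ℝ) * (α ^ 4) + (8 : ℝ) * (s * α ^ 4) + (216 : ℝ) * (s ^ 2 * α ^ 4)) * (S ^ 3 * C ^ 1) ≤ |-(8 : ℝ) * (α ^ 4) + (8 : ℝ) * (s * α ^ 4) + (216 : ℝ) * (s ^ 2 * α ^ 4)| :=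
    cterm_abs_le' (trig_abs_le' hS hC 3 1)
  have h13 : ((1 : ℝ) * (α ^ 5) + (24 : ℝ) * (s * α ^ 5)) * (S ^ 3 * C ^ 2) ≤ |(1 : ℝ) * (α ^ 5) + (24 : ℝ) * (s * α ^ 5)| :=
    cterm_abs_le' (trig_abs_le' hS hC 3 2)
  have h14 : ((48 : ℝ) * (s ^ 2 * α ^ 4 * c) - (4 : ℝ) * (s ^ 3 * α ^ 4 * c)) * (S ^ 4 * C ^ 0) ≤ |(48 : ℝ) * (s ^ 2 * α ^ 4 * c) - (4 : ℝ) * (s ^ 3 * α ^ 4 * c)| :=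
    cterm_abs_le' (trig_abs_le' hS hC 4 0)
  have h15 : ((2 : ℝ) * (s * α ^ 5 * c)) * (S ^ 4 * C ^ 1) ≤ |(2 : ℝ) * (s * α ^ 5 * c)| :=
    cterm_abs_le' (trig_abs_le' hS hC 4 1)
  have h16 : (-(24 : ℝ) * (s * α ^ 5)) * (S ^ 5 * C ^ 0) ≤ |-(24 : ℝ) * (s * α ^ 5)| :=
    cterm_abs_le' (trig_abs_le' hS hC 5 0)
  have h17 : (-(4 : ℝ) * (α ^ 6)) * (S ^ 5 * C ^ 1) ≤ |-(4 : ℝ) * (α ^ 6)| :=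
    cterm_abs_le' (trig_abs_le' hS hC 5 1)
  unfold tail2Coeff2 tail2Maj2
  linarith [h0, h1, h2, h3, h4, h5, h6, h7, h8, h9, h10, h11, h12, h13, h14, h15, h16, h17]

/-- `tail2Coeff1 ≤ tail2Maj1` for `|S|, |C| ≤ 1` and non-negative parameters. [folklore] -/
private lemma tail2Coeff1_le {s α c S C : ℝ} (_hs : 0 ≤ s) (_hα : 0 ≤ α) (_hc : 0 ≤ c) (hS : |S| ≤ 1)
    (hC : |C| ≤ 1) : tail2Coeff1 s α c S C ≤ tail2Maj1 s α c := by
  have h0 : (-(36 : ℝ) * (s * α)) * (S ^ 0 * C ^ 1) ≤ |-(36 : ℝ) * (s * α)| :=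
    cterm_abs_le' (trig_abs_le' hS hC 0 1)
  have h1 : (-(6 : ℝ) * (α ^ 2)) * (S ^ 0 * C ^ 2) ≤ |-(6 : ℝ) * (α ^ 2)| :=
    cterm_abs_le' (trig_abs_le' hS hC 0 2)
  have h2 : (-(12 : ℝ) * (s * α * c)) * (S ^ 1 * C ^ 0) ≤ |-(12 : ℝ) * (s * α * c)| :=
    cterm_abs_le' (trig_abs_le' hS hC 1 0)
  have h3 : ((96 : ℝ) * (s ^ 2 * α ^ 2 * c)) * (S ^ 1 * C ^ 1) ≤ |(96 : ℝ) * (s ^ 2 * α ^ 2 * c)| :=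
    cterm_abs_le' (trig_abs_le' hS hC 1 1)
  have h4 : ((6 : ℝ) * (α ^ 2) - (384 : ℝ) * (s ^ 2 * α ^ 2)) * (S ^ 2 * C ^ 0) ≤ |(6 : ℝ) * (α ^ 2) - (384 : ℝ) * (s ^ 2 * α ^ 2)| :=
    cterm_abs_le' (trig_abs_le' hS hC 2 0)
  have h5 : (-(120 : ℝ) * (s * α ^ 3)) * (S ^ 2 * C ^ 1) ≤ |-(120 : ℝ) * (s * α ^ 3)| :=
    cterm_abs_le' (trig_abs_le' hS hC 2 1)
  have h6 : (-(12 : ℝ) * (α ^ 4)) * (S ^ 2 * C ^ 2) ≤ |-(12 : ℝ) * (α ^ 4)| :=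
    cterm_abs_le' (trig_abs_le' hS hC 2 2)
  have h7 : (-(24 : ℝ) * (s * α ^ 3 * c)) * (S ^ 3 * C ^ 0) ≤ |-(24 : ℝ) * (s * α ^ 3 * c)| :=
    cterm_abs_le' (trig_abs_le' hS hC 3 0)
  have h8 : ((96 : ℝ) * (s ^ 2 * α ^ 4 * c)) * (S ^ 3 * C ^ 1) ≤ |(96 : ℝ) * (s ^ 2 * α ^ 4 * c)| :=
    cterm_abs_le' (trig_abs_le' hS hC 3 1)
  have h9 : ((12 : ℝ) * (α ^ 4) - (384 : ℝ) * (s ^ 2 * α ^ 4)) * (S ^ 4 * C ^ 0) ≤ |(12 : ℝ) * (α ^ 4) - (384 : ℝ) * (s ^ 2 * α ^ 4)| :=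
    cterm_abs_le' (trig_abs_le' hS hC 4 0)
  have h10 : (-(84 : ℝ) * (s * α ^ 5)) * (S ^ 4 * C ^ 1) ≤ |-(84 : ℝ) * (s * α ^ 5)| :=
    cterm_abs_le' (trig_abs_le' hS hC 4 1)
  have h11 : (-(6 : ℝ) * (α ^ 6)) * (S ^ 4 * C ^ 2) ≤ |-(6 : ℝ) * (α ^ 6)| :=
    cterm_abs_le' (trig_abs_le' hS hC 4 2)
  have h12 : (-(12 : ℝ) * (s * α ^ 5 * c)) * (S ^ 5 * C ^ 0) ≤ |-(12 : ℝ) * (s * α ^ 5 * c)| :=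
    cterm_abs_le' (trig_abs_le' hS hC 5 0)
  have h13 : ((6 : ℝ) * (α ^ 6)) * (S ^ 6 * C ^ 0) ≤ |(6 : ℝ) * (α ^ 6)| :=
    cterm_abs_le' (trig_abs_le' hS hC 6 0)
  unfold tail2Coeff1 tail2Maj1
  linarith [h0, h1, h2, h3, h4, h5, h6, h7, h8, h9, h10, h11, h12, h13]

/-- `tail2Coeff0 ≤ tail2Maj0` for `|S|, |C| ≤ 1` and non-negative parameters. [folklore] -/
private lemma tail2Coeff0_le {s α c S C : ℝ} (_hs : 0 ≤ s) (_hα : 0 ≤ α) (_hc : 0 ≤ c) (hS : |S| ≤ 1)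
    (hC : |C| ≤ 1) : tail2Coeff0 s α c S C ≤ tail2Maj0 s α c := by
  have h0 : (-(24 : ℝ) * (s * α * c)) * (S ^ 0 * C ^ 1) ≤ |-(24 : ℝ) * (s * α * c)| :=
    cterm_abs_le' (trig_abs_le' hS hC 0 1)
  have h1 : ((96 : ℝ) * (s * α)) * (S ^ 1 * C ^ 0) ≤ |(96 : ℝ) * (s * α)| :=
    cterm_abs_le' (trig_abs_le' hS hC 1 0)
  have h2 : ((12 : ℝ) * (α ^ 2)) * (S ^ 1 * C ^ 1) ≤ |(12 : ℝ) * (α ^ 2)| :=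
    cterm_abs_le' (trig_abs_le' hS hC 1 1)
  have h3 : (-(48 : ℝ) * (s * α ^ 3 * c)) * (S ^ 2 * C ^ 1) ≤ |-(48 : ℝ) * (s * α ^ 3 * c)| :=
    cterm_abs_le' (trig_abs_le' hS hC 2 1)
  have h4 : ((192 : ℝ) * (s * α ^ 3)) * (S ^ 3 * C ^ 0) ≤ |(192 : ℝ) * (s * α ^ 3)| :=
    cterm_abs_le' (trig_abs_le' hS hC 3 0)
  have h5 : ((24 : ℝ) * (α ^ 4)) * (S ^ 3 * C ^ 1) ≤ |(24 : ℝ) * (α ^ 4)| :=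
    cterm_abs_le' (trig_abs_le' hS hC 3 1)
  have h6 : (-(24 : ℝ) * (s * α ^ 5 * c)) * (S ^ 4 * C ^ 1) ≤ |-(24 : ℝ) * (s * α ^ 5 * c)| :=
    cterm_abs_le' (trig_abs_le' hS hC 4 1)
  have h7 : ((96 : ℝ) * (s * α ^ 5)) * (S ^ 5 * C ^ 0) ≤ |(96 : ℝ) * (s * α ^ 5)| :=
    cterm_abs_le' (trig_abs_le' hS hC 5 0)
  have h8 : ((12 : ℝ) * (α ^ 6)) * (S ^ 5 * C ^ 1) ≤ |(12 : ℝ) * (α ^ 6)| :=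
    cterm_abs_le' (trig_abs_le' hS hC 5 1)
  unfold tail2Coeff0 tail2Maj0
  linarith [h0, h1, h2, h3, h4, h5, h6, h7, h8]

/-- `0 ≤ tail2Maj5`. [folklore] -/
private lemma tail2Maj5_nonneg (s α c : ℝ) : 0 ≤ tail2Maj5 s α c := by
  unfold tail2Maj5; positivity

/-- `0 ≤ tail2Maj4`. [folklore] -/
private lemma tail2Maj4_nonneg (s α c : ℝ) : 0 ≤ tail2Maj4 s α c := by
  unfold tail2Maj4; positivity

/-- `0 ≤ tail2Maj3`. [folklore] -/
private lemma tail2Maj3_nonneg (s α c : ℝ) : 0 ≤ tail2Maj3 s α c := by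
  unfold tail2Maj3; positivity

/-- `0 ≤ tail2Maj2`. [folklore] -/
private lemma tail2Maj2_nonneg (s α c : ℝ) : 0 ≤ tail2Maj2 s α c := by
  unfold tail2Maj2; positivity

/-- `0 ≤ tail2Maj1`. [folklore] -/
private lemma tail2Maj1_nonneg (s α c : ℝ) : 0 ≤ tail2Maj1 s α c := by
  unfold tail2Maj1; positivity

/-- `0 ≤ tail2Maj0`. [folklore] -/
private lemma tail2Maj0_nonneg (s α c : ℝ) : 0 ≤ tail2Maj0 s α c := by
  unfold tail2Maj0; positivity

/-- The expansion IS the residual: `2s³θ⁵ · amplitudeResidual(w) = tail2Expansion(sin θ, cos θ, θ)` for `θ ≠ 0`, `s ≠ 0`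
(pure algebra after unfolding; no `sin² + cos² = 1` needed). [cite: Freidberg2014, §12.6.2 eq. (12.97)] -/
theorem amplitudeResidual_tail2Amplitude {s α c θ : ℝ} (hs : s ≠ 0) (hθ : θ ≠ 0) :
    2 * s ^ 3 * θ ^ 5 * amplitudeResidual s α (tail2Amplitude s α c) (tail2AmplitudeDeriv2 s α c) θ
      = tail2Expansion s α c (Real.sin θ) (Real.cos θ) θ := by
  unfold amplitudeResidual tail2Amplitude tail2AmplitudeDeriv2 tail2N tail2N1 tail2N2 tail2Expansion bending
    localShear shearParam tail2Coeff5 tail2Coeff4 tail2Coeff3 tail2Coeff2 tail2Coeff1 tail2Coeff0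
  field_simp
  ring

/-- THE TAIL CONDITION: `tail2Bound s α c T = 4cs⁷T⁶ − tail2Majorant(T)`.  `tail2Bound ≥ 0` at one `T > 0` makes the corrected
amplitude a supersolution on `[T, ∞)`; the leading coefficient being free of `α`, the condition only asks `c ≳ tail2Maj5/(4s⁷T)`.
[cite: Freidberg2014, §12.6.2 eq. (12.97)] (bookkeeping ours) -/
def tail2Bound (s α c T : ℝ) : ℝ := 4 * c * s ^ 7 * T ^ 6 - tail2Majorant s α c T

/-- Crude bound of the expansion by the majorant. [cite: Freidberg2014, §12.6.2 eq. (12.97)] (bookkeeping ours) -/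
theorem tail2Expansion_le {s α c S C θ : ℝ} (hs : 0 ≤ s) (hα : 0 ≤ α) (hc : 0 ≤ c) (hθ : 0 ≤ θ)
    (hS : |S| ≤ 1) (hC : |C| ≤ 1) :
    tail2Expansion s α c S C θ ≤ -((4 : ℝ) * (s ^ 7 * c)) * θ ^ 6 + tail2Majorant s α c θ := by
  have h5 := mul_le_mul_of_nonneg_right (tail2Coeff5_le hs hα hc hS hC) (pow_nonneg hθ 5)
  have h4 := mul_le_mul_of_nonneg_right (tail2Coeff4_le hs hα hc hS hC) (pow_nonneg hθ 4)
  have h3 := mul_le_mul_of_nonneg_right (tail2Coeff3_le hs hα hc hS hC) (pow_nonneg hθ 3)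
  have h2 := mul_le_mul_of_nonneg_right (tail2Coeff2_le hs hα hc hS hC) (pow_nonneg hθ 2)
  have h1 := mul_le_mul_of_nonneg_right (tail2Coeff1_le hs hα hc hS hC) (pow_nonneg hθ 1)
  have h0 := mul_le_mul_of_nonneg_right (tail2Coeff0_le hs hα hc hS hC) (pow_nonneg hθ 0)
  unfold tail2Expansion tail2Majorant
  linarith

/-- Scaling of the majorant along the ray: `tail2Majorant(θ) ≤ (θ/T)⁶ tail2Majorant(T)` for `θ ≥ T > 0`.
[cite: Freidberg2014, §12.6.2 eq. (12.97)] (bookkeeping ours) -/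
theorem tail2Majorant_scale {s α c θ T : ℝ} (hT : 0 < T) (hθ : T ≤ θ) :
    tail2Majorant s α c θ ≤ (θ / T) ^ 6 * tail2Majorant s α c T := by
  have g5 := scale_term6 5 (by norm_num) (tail2Maj5_nonneg s α c) hT hθ
  have g4 := scale_term6 4 (by norm_num) (tail2Maj4_nonneg s α c) hT hθ
  have g3 := scale_term6 3 (by norm_num) (tail2Maj3_nonneg s α c) hT hθ
  have g2 := scale_term6 2 (by norm_num) (tail2Maj2_nonneg s α c) hT hθ
  have g1 := scale_term6 1 (by norm_num) (tail2Maj1_nonneg s α c) hT hθ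
  have g0 := scale_term6 0 (by norm_num) (tail2Maj0_nonneg s α c) hT hθ
  unfold tail2Majorant
  nlinarith [g5, g4, g3, g2, g1, g0]

/-- **THE CORRECTED TAIL AMPLITUDE IS A SUPERSOLUTION ON `[T, ∞)` AS SOON AS `tail2Bound s α c T ≥ 0`.**
[cite: Freidberg2014, §12.6.2 eq. (12.97)] (explicit supersolution of its Liouville normal form; ours) -/
theorem amplitudeResidual_tail2Amplitude_nonpos {s α c T θ : ℝ} (hs : 0 < s) (hα : 0 ≤ α) (hc : 0 ≤ c)
    (hT : 0 < T) (hB : 0 ≤ tail2Bound s α c T) (hθ : T ≤ θ) :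
    amplitudeResidual s α (tail2Amplitude s α c) (tail2AmplitudeDeriv2 s α c) θ ≤ 0 := by
  have hθpos : 0 < θ := hT.trans_le hθ
  have hE := amplitudeResidual_tail2Amplitude (c := c) (α := α) hs.ne' hθpos.ne'
  have h1 := tail2Expansion_le (S := Real.sin θ) (C := Real.cos θ) hs.le hα hc hθpos.le
    (Real.abs_sin_le_one θ) (Real.abs_cos_le_one θ)
  have h2 := tail2Majorant_scale (s := s) (α := α) (c := c) hT hθ
  have hρ6 : 0 ≤ (θ / T) ^ 6 := by positivity
  have h3 : (θ / T) ^ 6 * tail2Majorant s α c T ≤ (θ / T) ^ 6 * (4 * c * s ^ 7 * T ^ 6) := by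
    apply mul_le_mul_of_nonneg_left _ hρ6
    unfold tail2Bound at hB; linarith
  have h4 : (θ / T) ^ 6 * (4 * c * s ^ 7 * T ^ 6) = 4 * c * s ^ 7 * θ ^ 6 := by
    rw [div_pow]; field_simp
  have hle : 2 * s ^ 3 * θ ^ 5 * amplitudeResidual s α (tail2Amplitude s α c) (tail2AmplitudeDeriv2 s α c) θ ≤ 0 := by
    rw [hE]; linarith
  have hpos : 0 < 2 * s ^ 3 * θ ^ 5 := by positivity
  by_contra hcon
  have hcon' := not_le.1 hcon
  have := mul_pos hpos hcon'
  linarith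

/-! ## §6.4 Energy domination on the tail and the stable side -/

/-- **ENERGY DOMINATION ON THE TAIL `[T, ∞)`** by the phase of the corrected amplitude, under `0 < s`, `0 ≤ α`, `0 ≤ c`,
`0 < T`, `tail2Floor s α c T > 0` (positivity) and `tail2Bound s α c T ≥ 0`. [cite: Hartman2002, Ch. XI §6 Thm. 6.2]
(Picone sufficiency) for the operator of [Freidberg2014] §12.6.2 eq. (12.97) -/
theorem energyDominatesOn_tail2 {s α c T : ℝ} (hs : 0 < s) (hα : 0 ≤ α) (hc : 0 ≤ c) (hT : 0 < T)
    (hfloor : 0 < tail2Floor s α c T) (hB : 0 ≤ tail2Bound s α c T) :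
    EnergyDominatesOn s α (amplitudePhase s α (tail2Amplitude s α c) (tail2AmplitudeDeriv s α c)) (Ici T) := by
  have hne : ∀ θ ∈ Ici T, θ ≠ 0 := fun θ hθ => (hT.trans_le hθ).ne'
  refine energyDominatesOn_of_amplitude (F'' := tail2AmplitudeDeriv2 s α c)
    (fun θ hθ => hasDerivAt_tail2Amplitude (hne θ hθ))
    (fun θ hθ => hasDerivAt_tail2AmplitudeDeriv (hne θ hθ))
    (continuousOn_tail2AmplitudeDeriv2 hT) ?_ ?_
  · intro θ hθ
    exact hfloor.trans_le (tail2Floor_le hs hα hc hT hθ)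
  · intro θ hθ
    exact amplitudeResidual_tail2Amplitude_nonpos hs hα hc hT hB hθ

/-- **STABLE SIDE FROM A CORE AMPLITUDE AND THE CORRECTED TAIL.**  Side conditions on `(s, α, c, T)`: `0 < s`, `0 ≤ α`,
`0 ≤ c`, `0 < T`, `tail2Floor s α c T > 0`, `tail2Bound s α c T ≥ 0`; a CORE amplitude `F > 0` on `[0, T]`, twice
differentiable with continuous `F″`, `F′(0) = 0`, amplitude inequality on `[0, T]`, and the junction inequality
`tail2Slope s α c T / tail2Floor s α c T ≤ F′(T)/F(T)`.  Then `(s, α)` is on the stable side of the `s–α` model.  (All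
numeric side conditions are decidable by `norm_num` at rational data; the core inequality is the panel certificate.)
[cite: Freidberg2014, §12.3 eq. (12.40)] (Newcomb procedure on `−∞ < θ < ∞`) with [Hartman2002] Ch. XI §6 Thm. 6.2 -/
theorem stableSide_of_core_amplitude_tail2 {s α c T : ℝ} {F F' F'' : ℝ → ℝ}
    (hs : 0 < s) (hα : 0 ≤ α) (hc : 0 ≤ c) (hT : 0 < T) (hfloor : 0 < tail2Floor s α c T)
    (hB : 0 ≤ tail2Bound s α c T)
    (hF : ∀ θ ∈ Icc 0 T, HasDerivAt F (F' θ) θ) (hF' : ∀ θ ∈ Icc 0 T, HasDerivAt F' (F'' θ) θ)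
    (hF''c : ContinuousOn F'' (Icc 0 T)) (hFpos : ∀ θ ∈ Icc 0 T, 0 < F θ) (hF'0 : F' 0 = 0)
    (hFres : ∀ θ ∈ Icc 0 T, amplitudeResidual s α F F'' θ ≤ 0)
    (hjump : tail2Slope s α c T / tail2Floor s α c T ≤ F' T / F T) :
    StableSide s α := by
  refine stableSide_of_core_tail hT (energyDominatesOn_of_amplitude hF hF' hF''c hFpos hFres)
    (amplitudePhase_zero_of_deriv_zero hF'0).le (energyDominatesOn_tail2 hs hα hc hT hfloor hB) ?_
  rw [amplitudePhase_le_iff]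
  exact (tail2_logDeriv_le hs hα hc hT hfloor).trans hjump

end SAlpha

end Ballooning

end Literature.MathematicalPhysics.MHD

end
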